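import Mathlib
import Literature.Computability.AlgebraicComplexity.StandardFamilies
import Literature.Computability.AlgebraicComplexity.DeterminantalComplexityProofs
import Literature.Computability.AlgebraicComplexity.PermanentVsDeterminantProofs
import Summits.ValiantsHypothesis.ValiantsHypothesis.Theses.RefutationDegree
import Summits.ValiantsHypothesis.ValiantsHypothesis.Theorems.RefutationDegreeDefs
import Summits.ValiantsHypothesis.ValiantsHypothesis.Theorems.RefutationDegreeSosSound
import Summits.ValiantsHypothesis.ValiantsHypothesis.Theorems.RefutationDegreeRefutationBarrierStubHasSosRefOfHasNsRef
import Summits.ValiantsHypothesis.ValiantsHypothesis.Theorems.RefutationDegreeRefutationBarrierConverse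

/-!
# Crux `RefutationBarrier` (stmt-ValiantsHypothesis-5642), line `Sketch-ideator1`: the positive horn
refutes the barrier horn, UNCONDITIONALLY (the route's kill switch)

Lead's file (prover-line-stmt-ValiantsHypothesis-5642-c1-0).  Two book-keeping facts about the crux
that hold with NO named-fact hypothesis (no Skoda–Brownawell):

* THE FEASIBLE RANGE OF EVERY INSTANCE.  By soundness (`SosSound`, proved in the tree as
  `sosSound_proof`) there is no Hermitian-SOS refutation of Rep(n,m), of any degree, once
  `m ≥ dc(per_n)`; with Grenet's `dc(per_n) ≤ 2ⁿ − 1` (`determinantalComplexity_perPoly_le_holds`) the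
  instance `(c, n, m)` of `RefutationBarrier` is a THEOREM whenever `m + 1 ≥ 2ⁿ`
  (`not_hasSosRef_of_two_pow_le`).  Together with the degree grading of the Grading file
  (`refutationBarrier_large`: the instance holds whenever `m > n ^ c`, `m ≥ n`) the content of the crux
  is exactly the window `⌊n²/2⌋ + 1 ≤ m ≤ min (n ^ c) (2ⁿ − 2)`.
* THE KILL SWITCH (the planner's kill criterion; the route-review refuter's `EvR1KillSwitch.lean`, now
  in the tree, stated towards the crux): each positive-horn item of route `RefutationDegree` refutes
  the barrier horn — `CertWindowQP → ¬ RefutationBarrier` (`not_refutationBarrier_of_certWindowQP`),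
  `BeyondHessianSos → ¬ RefutationBarrier`, `BeyondHessianNs → ¬ RefutationBarrier`.  Proof of the first:
  given the target's exponent `c'`, take the barrier at exponent `3c'` (threshold `n₀`) and feed
  `c := max n₀ 2` to the target; its witness `n` is either `< c` — then the window
  `m ≤ 2^((log₂ n + c)^c) ⊇ [0, 2ⁿ]` contains the FEASIBLE size `2ⁿ − 1`, where soundness forbids a
  certificate — or `≥ c ≥ n₀`, and then `m₁ = ⌊n²/2⌋+1 ≤ n² ≤ 2^((log₂ n + c)^c)` lies in the window
  with certificate degree `(m₁ + 2)^{c'} ≤ n^{3c'}`, which the barrier forbids.  So the two horns of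
  the route are formally incompatible given soundness: a proof of any of `CertWindowQP`,
  `BeyondHessianSos`, `BeyondHessianNs` refutes the crux, and a proof of the crux refutes all three.

Vocabulary from `Theorems/RefutationDegreeDefs.lean` (`HasSosRef`, `HasNsRef`, the `*_iff` unfoldings);
`hasSosRef_mono` from the Converse file.  All folklore.
-/

-- `Summit.ValiantsHypothesis.ValiantsHypothesis.…` is the tree's mandated single-conjunct layout
-- (Sub = Summit), so the duplicated namespace component is intended.
set_option linter.dupNamespace false

noncomputable section

namespace Summit.ValiantsHypothesis.ValiantsHypothesis.Theorems.RefutationDegree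

open scoped BigOperators
open MvPolynomial
open Literature.Computability.AlgebraicComplexity (perPoly HasDetRepr determinantalComplexity)
open Summit.ValiantsHypothesis.ValiantsHypothesis.Theses.RefutationDegree

/-! ### Soundness in the route's vocabulary and the feasible range -/

/-- Soundness (`sosSound_proof`) in the vocabulary of `RefutationDegreeDefs`: a size-`m` affine
determinantal expression of `per_n` excludes Hermitian-SOS refutations of Rep(n,m) of every degree.
[folklore] -/
theorem not_hasSosRef_of_hasDetRepr {n m : ℕ} (D : ℕ) (h : HasDetRepr (perPoly (Fin n) ℂ) m) :
    ¬ HasSosRef n m D :=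
  fun hs => (sosSound_iff.mp Theorems.sosSound_proof) n m D hs h

/-- Past the determinantal complexity there is nothing to refute: `dc(per_n) ≤ m` excludes
Hermitian-SOS refutations of Rep(n,m) of every degree (attainment of `dc` and padding). [folklore] -/
theorem not_hasSosRef_of_determinantalComplexity_le {n m : ℕ} (D : ℕ)
    (h : determinantalComplexity (perPoly (Fin n) ℂ) ≤ m) : ¬ HasSosRef n m D :=
  not_hasSosRef_of_hasDetRepr D
    ((Literature.Computability.AlgebraicComplexity.hasDetRepr_iff_determinantalComplexity_le_holds
      _ m).2 h)

/-- **The feasible range of every instance of the crux is a theorem**: for `2ⁿ ≤ m + 1` (Grenet's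
range `m ≥ 2ⁿ − 1`, where `per_n` HAS a size-`m` affine determinantal expression; `n = 0`: the empty
determinant) Rep(n,m) has no Hermitian-SOS
refutation of ANY product degree `D`.  (The other unconditional range, `m > D` for `m ≥ n`, is
`not_hasSosRef_of_lt` / `refutationBarrier_large` of the Grading file; the content of the crux is the
window `⌊n²/2⌋+1 ≤ m ≤ min (n^c) (2ⁿ − 2)`.) [folklore] -/
theorem not_hasSosRef_of_two_pow_le {n m : ℕ} (D : ℕ) (h : 2 ^ n ≤ m + 1) : ¬ HasSosRef n m D := by
  rcases Nat.eq_zero_or_pos n with rfl | hn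
  · -- `per_0 = 1` is the determinant of the empty matrix (cf. `hasDetRepr_perPoly_fin_zero`)
    have h0 : HasDetRepr (perPoly (Fin 0) ℂ) 0 :=
      ⟨1, fun i => Fin.elim0 i, by simp [perPoly, Matrix.permanent_isEmpty]⟩
    exact not_hasSosRef_of_determinantalComplexity_le _ ((Nat.sInf_le h0).trans (Nat.zero_le _))
  · refine not_hasSosRef_of_determinantalComplexity_le _ ?_
    have hG :=
      Literature.Computability.AlgebraicComplexity.determinantalComplexity_perPoly_le_holds ℂ n hn
    omega

/-! ### The kill switch: each positive-horn item refutes the barrier horn -/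

/-- Window arithmetic, small witnesses: for `n < c` the quasi-polynomial window at `(n, c)` contains
`[0, 2ⁿ]`. -/
theorem two_pow_le_window_of_lt {n c : ℕ} (hnc : n < c) :
    2 ^ n ≤ 2 ^ ((Nat.log 2 n + c) ^ c) := by
  have hc : c ≠ 0 := by omega
  apply Nat.pow_le_pow_right (by norm_num)
  calc n ≤ c := hnc.le
    _ ≤ c ^ c := Nat.le_self_pow hc c
    _ ≤ (Nat.log 2 n + c) ^ c := Nat.pow_le_pow_left (Nat.le_add_left c _) c

/-- Window arithmetic, large witnesses: for `2 ≤ c` the quasi-polynomial window at `(n, c)` contains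
`[0, n²]`, in particular the quadratic size `⌊n²/2⌋ + 1`. -/
theorem quadSize_le_window {n c : ℕ} (hc : 2 ≤ c) :
    n ^ 2 / 2 + 1 ≤ 2 ^ ((Nat.log 2 n + c) ^ c) := by
  set L := Nat.log 2 n with hL
  have hn : n < 2 ^ (L + 1) := Nat.lt_pow_succ_log_self (by norm_num) n
  have hsq : n ^ 2 < 2 ^ (2 * L + 2) := by
    have e : 2 ^ (2 * L + 2) = (2 ^ (L + 1)) ^ 2 := by ring
    rw [e]
    exact Nat.pow_lt_pow_left hn (by norm_num)
  have hexp : 2 * L + 2 ≤ (L + c) ^ c := by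
    calc 2 * L + 2 ≤ (L + c) ^ 2 := by nlinarith
      _ ≤ (L + c) ^ c := Nat.pow_le_pow_right (by omega) hc
  have hpow : 2 ^ (2 * L + 2) ≤ 2 ^ ((L + c) ^ c) := Nat.pow_le_pow_right (by norm_num) hexp
  -- `n²/2 + 1 ≤ n²` needs `n ≥ 2`; for `n ≤ 1` the left side is `1 ≤ 2^…`.
  rcases Nat.lt_or_ge n 2 with hsmall | hbig
  · have h1 : n ^ 2 / 2 + 1 = 1 := by interval_cases n <;> simp
    rw [h1]
    exact Nat.one_le_two_pow
  · have h4 : 4 ≤ n ^ 2 := by nlinarith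
    omega

/-- Degree arithmetic: the target's budget at the quadratic size is polynomial in `n`:
`(⌊n²/2⌋ + 3)^{c'} ≤ n^{3c'}` for `n ≥ 2`. -/
theorem quadSize_budget_le {n : ℕ} (c' : ℕ) (hn : 2 ≤ n) :
    (n ^ 2 / 2 + 1 + 2) ^ c' ≤ n ^ (3 * c') := by
  have hbase : n ^ 2 / 2 + 1 + 2 ≤ n ^ 3 := by
    have h1 : n ^ 2 / 2 ≤ n ^ 2 := Nat.div_le_self _ _
    have h2 : n ^ 2 + 3 ≤ n ^ 3 := by
      have e : n ^ 3 = n * n ^ 2 := by ring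
      have h4 : 4 ≤ n ^ 2 := by nlinarith
      rw [e]; nlinarith
    omega
  calc (n ^ 2 / 2 + 1 + 2) ^ c' ≤ (n ^ 3) ^ c' := Nat.pow_le_pow_left hbase c'
    _ = n ^ (3 * c') := by rw [← pow_mul]

/-- **KILL SWITCH** (the planner's kill criterion of route `RefutationDegree`, unconditionally): the
target refutes the barrier horn — if `CertWindowQP` holds then `RefutationBarrier` fails.  The two
horns of the route are formally incompatible given soundness, which is proved (`sosSound_proof`).
[folklore] -/
theorem not_refutationBarrier_of_certWindowQP (hX : CertWindowQP) : ¬ RefutationBarrier := by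
  rw [certWindowQP_iff] at hX
  rw [refutationBarrier_iff]
  intro hB
  obtain ⟨c', hX⟩ := hX
  obtain ⟨n₀, hn₀⟩ := hB (3 * c')
  obtain ⟨n, hn⟩ := hX (max n₀ 2)
  rcases Nat.lt_or_ge n (max n₀ 2) with hsmall | hbig
  · -- small witness: the window contains the feasible size `2ⁿ − 1`
    have hwin : 2 ^ n - 1 ≤ 2 ^ ((Nat.log 2 n + max n₀ 2) ^ max n₀ 2) :=
      (Nat.sub_le _ _).trans (two_pow_le_window_of_lt hsmall)
    exact not_hasSosRef_of_two_pow_le _ (by have := @Nat.one_le_two_pow n; omega) (hn _ hwin)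
  · -- large witness: the quadratic size is in the window, with polynomial certificate degree
    have hn₀n : n₀ ≤ n := le_trans (le_max_left _ _) hbig
    have hn2 : 2 ≤ n := le_trans (le_max_right _ _) hbig
    have hcert := hn (n ^ 2 / 2 + 1) (quadSize_le_window (le_max_right _ _))
    exact hn₀ n hn₀n (n ^ 2 / 2 + 1) le_rfl
      (hasSosRef_mono _ _ (quadSize_budget_le c' hn2) hcert)

/-- The weak positive step refutes the barrier horn: `BeyondHessianSos → ¬ RefutationBarrier`
(same exponent, the larger of the two thresholds). [folklore] -/
theorem not_refutationBarrier_of_beyondHessianSos (hpos : BeyondHessianSos) : ¬ RefutationBarrier := by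
  rw [beyondHessianSos_iff] at hpos
  rw [refutationBarrier_iff]
  intro hB
  obtain ⟨c, n₁, hpos⟩ := hpos
  obtain ⟨n₀, hn₀⟩ := hB c
  exact hn₀ (max n₀ n₁) (le_max_left _ _) _ le_rfl (hpos (max n₀ n₁) (le_max_right _ _))

/-- The strong positive step refutes the barrier horn: `BeyondHessianNs → ¬ RefutationBarrier`
(a Nullstellensatz refutation is a Hermitian-SOS refutation of the same degree,
`stub_hasSosRef_of_hasNsRef`). [folklore] -/
theorem not_refutationBarrier_of_beyondHessianNs (hpos : BeyondHessianNs) : ¬ RefutationBarrier := by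
  rw [beyondHessianNs_iff] at hpos
  rw [refutationBarrier_iff]
  intro hB
  obtain ⟨c, n₁, hpos⟩ := hpos
  obtain ⟨n₀, hn₀⟩ := hB c
  exact hn₀ (max n₀ n₁) (le_max_left _ _) _ le_rfl
    (stub_hasSosRef_of_hasNsRef _ _ _ (hpos (max n₀ n₁) (le_max_right _ _)))

end Summit.ValiantsHypothesis.ValiantsHypothesis.Theorems.RefutationDegree

end
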